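import Summits.HodgeConjecture.HodgeConjecture.Theorems.H413MirrorAtPinLine          -- ★ `exists_conjPartner_omegaAtLine_neg` (the conjugate partner, GENERIC in `(L, V)`)
import Summits.HodgeConjecture.HodgeConjecture.Theorems.H413CohFormsCarriersLemmas   -- ★ carriers `holCotForms` ∕ `cohForms` ∕ `rightRep` ∕ `conjFun`, `conjFun_rightRep`, `conjFun_conjFun`
import Summits.HodgeConjecture.HodgeCM.Model.LiuDictionaryPin                        -- ★ `ιVE` (the finite-adelic frame of record, as in ENGINE-GEN)
import HarnessLib

/-!
# Crux `H413`, programme P2 — ROAD A residual R1b «ORIENTATION»: the occurrence clause of `ω(μ, ⟨a⟩, χ)` in `cohForms` FROM the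
# holomorphic clause of its CONJUGATE PARTNER `ω(μ′, ⟨−a⟩, χ̄)` — off the pin (any packaged CM frame `(L, V)`)

Cell hodgecm-mathlib (D-0151), FLOOR 0, crux item H413 = stmt-HodgeConjecture-24833 (`HCCMUnconditional.H413`); programme P2, books #173
(Θ-OCC-GEN), ROAD A «ENGINE» of PLAN-P2 v14 (desk F0P2-plan (g13)): #173 ⟸ ★ ENGINE-GEN `F0P2sThetaOccursInEngineGen.exists_holTheta_atFrame_of_chiN`
(F0P2-p01 (g12), p844477) ∘ ★ output adapter (p844332) with inputs χN-GEN (F0P2-p06 (N7) ★ p844576, (N8) p844615) and ORIENT-GEN.  The engine is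
HOLOMORPHIC: it needs `hι : ι₁ ∈ Φ_μ`.  ENGINE-GEN's honest residual (R1b): «when `ι₁ ∉ Φ_μ` the global theta lift is ANTIholomorphic at `ι₁`
([Liu2021, Lem. D.2 (2)]) and this HOL engine does not apply».  THIS FILE is the R1b transport OFF THE PIN — programme P4's `stubT3_of` ∕ ★
`H413HoccGlue.thetaFormsAt_of_hol_of_partner` («via partner»: `θ := conjFun ∘ θ′ ∘ J`) re-typed at an ARBITRARY packaged CM frame `(L, V)` and an
ARBITRARY weight-one conjugate-symplectic `μ`, over ★ `H413MirrorAtPinLine.exists_conjPartner_omegaAtLine_neg` (F0P4-p03; GENERIC in `(L, V, μ, a, χ)`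
by signature: a bijective conjugate-linear `U(V)(𝔸_f)`-equivariant `J : ω(μ, ⟨a⟩, χ) → ω(μ′, ⟨−a⟩, χ̄)`, `μ′` of weight one with `Φ_(μ′) = Φ̄_μ`,
[Liu2021, App. D Lem. D.1 (2)] «`ω(μ,ε,χ)‾ ≅ ω(μᶜ, −ε, χ⁻¹)`»).  Author F0P2-p06 (g8).  `--supports stmt-HodgeConjecture-24833` (helper; THEOREMS ONLY —
no definition, no instance, no `sorry`; 0 `Lines` imports).  HC_CM is proved only modulo the 2 remaining named inputs (hLiu418, h413) until rung 0
closes; this file discharges no printed citation by itself.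

## What is proved
* §1 **`occursClause_cohForms_of_semilinear_partner`** (pure algebra, any archimedean factor `𝔞`, any actions `σ, σ′` of `U(V)(𝔸_f)` on any
  `ℂ`-modules `Ω, Ω′`): a SURJECTIVE conjugate-linear `J : Ω → Ω′` with `J (σ g v) = σ′ g (J v)` carries the clause «`∃ θ′ : Ω′ →ₗ[ℂ] (U(V)(𝔸) → ℂ²),
  θ′ ≠ 0 ∧ (∀ v, θ′ v ∈ holCotForms 𝔞) ∧ ∀ g v, θ′ (σ′ g v) = rightRep g (θ′ v)`» to «`∃ θ : Ω →ₗ[ℂ] …, θ ≠ 0 ∧ (∀ v, θ v ∈ cohForms 𝔞) ∧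
  ∀ g v, θ (σ g v) = rightRep g (θ v)`» — `θ := conjFun ∘ θ′ ∘ J` (two conjugations make it `ℂ`-linear; values in `conjFun (holCotForms 𝔞) ≤ cohForms 𝔞`
  = the ANTIholomorphic summand [BorelWallach2000, VII 2.10]; equivariance by ★ `conjFun_rightRep`; non-zero as `J` is onto and `conjFun` injective);
  and the direct summand **`occursClause_cohForms_of_hol`** (`holCotForms 𝔞 ≤ cohForms 𝔞`).
* §2 **`occursClause_cohForms_of_conjPartner_hol`** — for a packaged CM frame `(L, V)` (`V : HermSpace3 L ι₁`), `μ` conjugate-symplectic of weight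
  one with CM type `Φ`, a unit `a` and `χ ∈ Chi`: IF for every weight-one conjugate-symplectic `μ′` with `HasCMType μ′ Φ̄` the carriers
  `ω(μ′, ⟨−a⟩, χ̄)` (`omegaAtLine … (hsChiD … (toHeckeCharacter μ′) …) (−a) χ̄`) admit the HOLOMORPHIC clause (values in `holCotForms (archFactorOf L V)`,
  equivariance along `rhoVAtLine … (ιVE V g)` — EXACTLY the conclusion shape of ★ ENGINE-GEN), THEN `ω(μ, ⟨a⟩, χ)` admits the clause with values in
  `cohForms (archFactorOf L V)` — the INPUT SHAPE `hE` of ★ (Ta) `F0P2sThetaOccursInArchTransport.occursClause_cohForms_frame_of_archFactorOf` ∘ the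
  output adapter.  Use (LEAD ∕ p01): at a frame with `(mk ι₁).embedding = ι₁` and `ι₁ ∉ Φ_μ`, `Φ̄_μ ∋ ι₁`, so ENGINE-GEN applies to the partner data
  `(μ′, χ̄, −e, −a)` (`−e` is `Φ̄_μ`-admissible and `−a = (−e)·2δ_L` when `a = e·2δ_L`; χN-GEN (N8) is stated for every `(μ₀, χ, e, a)`), and this
  theorem returns the letter's clause for `(μ, a, χ)` — the two orientations `ι₁ ∈ Φ_μ` ∕ `ι₁ ∉ Φ_μ` of R1b are thereby both routed to `cohForms`.
  What R1 still needs after this file: (R1a) the coordinate normalisation `(mk ι₁).embedding = ι₁` of the model (ENGINE-GEN's `hemb`).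

## References
* [Liu2021] Y. Liu, Camb. J. Math. 9 (2021) = arXiv:2102.11518: proof of Prop. 4.13 («Conversely» l. 2145–2149); App. D Lem. D.1 (2) (l. 5231),
  Lem. D.2 (2); Def. 4.11–4.12.
* [BorelWallach2000] A. Borel, N. Wallach, 2nd ed. (2000), VII 2.10 (Hodge types `(1,0)` ∕ `(0,1)` of the cohomological representations of `U(2,1)`).
* [GelbartRogawski1991] Invent. Math. 105 (1991), §3.1 Prop. 3.1.1 p. 455, Remark p. 457.
* Tree (all ★): `Theorems/H413MirrorAtPinLine` (partner), `Theorems/H413CohFormsCarriers(Lemmas)` (carriers, `conjFun`), `Theorems/H413HoccGlue`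
  (`thetaFormsAt_of_hol_of_partner`, the pin template), `HodgeCM/Model/LiuDictionaryPin` (`ιVE`), `Theorems/F0P2sThetaOccursInEngineGen` (consumer shape).
-/

set_option autoImplicit false
set_option linter.dupNamespace false

noncomputable section

open NumberField NumberField.InfinitePlace NumberField.ComplexEmbedding NumberField.mixedEmbedding IsDedekindDomain
open scoped Matrix SchwartzMap Classical TensorProduct ComplexConjugate
open Literature.RepresentationTheory
open Literature.NumberTheory.Automorphic Literature.NumberTheory.Automorphic.UnitaryGroup Literature.NumberTheory.Weil1964
open Literature.NumberTheory.GelbartRogawski1991 Literature.NumberTheory.GelbartRogawski1991.UnitaryDualPair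
open Literature.NumberTheory.GelbartRogawski1991.UnitaryDualPair.WeilCoinv
open Literature.NumberTheory.GelbartRogawski1991.GRConstruction
open Literature.NumberTheory.Automorphic.Liu2021.Def411WeilCarriersDoubling
open Literature.NumberTheory.Automorphic.Liu2021.Def411WeilCarriers
open Literature.NumberTheory.Automorphic.IdeleClassGroup
open Literature.NumberTheory.GaloisRepresentations
open Literature.NumberTheory.ComplexMultiplication.CMTypeOps (bar mem_bar_iff)
open Literature.RepresentationTheory.HarrisKudlaSweet1996
open HodgeCM HodgeCM.Model HodgeCM.Model.LiuIndex
open HodgeCM.Model.ArchSideTerm (e₁)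
open Summit.HodgeConjecture.CorCM.Transposition.OmegaChiSplitting (sChiD hsChiD)
open Summit.HodgeConjecture.HodgeConjecture.Cruxes.H413.CohFormsCarriers
open Summit.HodgeConjecture.HodgeConjecture.Cruxes.H413.MirrorAtPinLine

namespace Summit.HodgeConjecture.HodgeConjecture.Cruxes.H413.F0P2tOccursClauseViaPartner

/-! ## §1 Pure algebra: the clause through a conjugate-linear equivariant surjection (`θ := conjFun ∘ θ′ ∘ J`) -/

section Generic

variable (L : HodgeCM.CMField) {ι₁ : (L : Type) →+* ℂ} (V : HodgeCM.HermSpace3 L ι₁) (𝔞 : ArchFactor L V)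
  {Ω Ω' : Type} [AddCommGroup Ω] [Module ℂ Ω] [AddCommGroup Ω'] [Module ℂ Ω']

/-- **the direct summand**: a holomorphic occurrence is a cohomological one (`holCotForms 𝔞 ≤ cohForms 𝔞`). [cite: BorelWallach2000, VII 2.10] -/
theorem occursClause_cohForms_of_hol (σ : ↥(HodgeCM.HermSpace3.adelicFin V) → Ω → Ω)
    (hhol : ∃ θ : Ω →ₗ[ℂ] ((adelicDatum L V).Adelic → (Fin 2 → ℂ)), θ ≠ 0 ∧ (∀ v, θ v ∈ holCotForms 𝔞) ∧
      ∀ (g : ↥(HodgeCM.HermSpace3.adelicFin V)) (v : Ω), θ (σ g v) = rightRep L V g (θ v)) :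
    ∃ θ : Ω →ₗ[ℂ] ((adelicDatum L V).Adelic → (Fin 2 → ℂ)), θ ≠ 0 ∧ (∀ v, θ v ∈ cohForms 𝔞) ∧
      ∀ (g : ↥(HodgeCM.HermSpace3.adelicFin V)) (v : Ω), θ (σ g v) = rightRep L V g (θ v) := by
  obtain ⟨θ, hθ, hθA, hθeq⟩ := hhol
  exact ⟨θ, hθ, fun v => Submodule.mem_sup_left (hθA v), hθeq⟩

/-- **«VIA PARTNER» (pure algebra)**: a SURJECTIVE conjugate-linear `J : Ω → Ω′` intertwining the actions `σ, σ′` of `U(V)(𝔸_f)` turns a holomorphic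
occurrence `θ′` of `Ω′` into the cohomological (antiholomorphic) occurrence `θ := conjFun ∘ θ′ ∘ J` of `Ω`: `ℂ`-linear (two conjugations), non-zero
(`J` onto, `conjFun` injective by ★ `conjFun_conjFun`), valued in `conjFun (holCotForms 𝔞) ≤ cohForms 𝔞`, equivariant by ★ `conjFun_rightRep`.
Programme P4's `viaPartner` (★ `H413HoccGlue.thetaFormsAt_of_hol_of_partner`) with the pin's datum abstracted away.
[cite: Liu2021, App. D Lem. D.1 (2) (l. 5231), Lem. D.2 (2)] [cite: BorelWallach2000, VII 2.10] -/
theorem occursClause_cohForms_of_semilinear_partner (σ : ↥(HodgeCM.HermSpace3.adelicFin V) → Ω → Ω)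
    (σ' : ↥(HodgeCM.HermSpace3.adelicFin V) → Ω' → Ω') (J : Ω →ₛₗ[starRingEnd ℂ] Ω') (hJ : Function.Surjective J)
    (hJeq : ∀ (g : ↥(HodgeCM.HermSpace3.adelicFin V)) (v : Ω), J (σ g v) = σ' g (J v))
    (hhol : ∃ θ' : Ω' →ₗ[ℂ] ((adelicDatum L V).Adelic → (Fin 2 → ℂ)), θ' ≠ 0 ∧ (∀ v, θ' v ∈ holCotForms 𝔞) ∧
      ∀ (g : ↥(HodgeCM.HermSpace3.adelicFin V)) (v : Ω'), θ' (σ' g v) = rightRep L V g (θ' v)) :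
    ∃ θ : Ω →ₗ[ℂ] ((adelicDatum L V).Adelic → (Fin 2 → ℂ)), θ ≠ 0 ∧ (∀ v, θ v ∈ cohForms 𝔞) ∧
      ∀ (g : ↥(HodgeCM.HermSpace3.adelicFin V)) (v : Ω), θ (σ g v) = rightRep L V g (θ v) := by
  obtain ⟨θ', hθ', hθ'A, hθ'eq⟩ := hhol
  -- the conjugate sandwich `v ↦ conj (θ' (J v))` is ℂ-linear (two conjugations)
  let S : Ω →ₗ[ℂ] ((adelicDatum L V).Adelic → (Fin 2 → ℂ)) :=
    { toFun := fun v => conjFun L V (θ' (J v))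
      map_add' := fun v w => by simp only [map_add]
      map_smul' := fun c v => by simp only [LinearMap.map_smulₛₗ, RingHom.id_apply, starRingEnd_self_apply] }
  have hS : ∀ v, S v = conjFun L V (θ' (J v)) := fun _ => rfl
  refine ⟨S, ?_, fun v => ?_, fun g v => ?_⟩
  · -- non-vanishing
    obtain ⟨w, hw⟩ : ∃ w, θ' w ≠ 0 := by
      by_contra hall
      push Not at hall
      exact hθ' (LinearMap.ext hall)
    obtain ⟨v, rfl⟩ := hJ w
    intro hzero
    apply hw
    have h1 : conjFun L V (θ' (J v)) = 0 := by
      have := LinearMap.congr_fun hzero v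
      simpa only [hS, LinearMap.zero_apply] using this
    have h2 : conjFun L V (θ' (J v)) = conjFun L V 0 := by rw [h1, map_zero]
    exact (Function.LeftInverse.injective (conjFun_conjFun L V)) h2
  · -- values in `conjFun (holCotForms 𝔞) ≤ cohForms 𝔞`
    simp only [hS]
    exact Submodule.mem_sup_right (Submodule.mem_map_of_mem (hθ'A (J v)))
  · -- equivariance
    simp only [hS, hJeq, hθ'eq]
    exact conjFun_rightRep L V g (θ' (J v))

end Generic

/-! ## §2 At a packaged CM frame: `ω(μ, ⟨a⟩, χ)` occurs in `cohForms` if its conjugate partners `ω(μ′, ⟨−a⟩, χ̄)` occur holomorphically -/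

section Partner

variable {L : HodgeCM.CMField} {ι₁ : (L : Type) →+* ℂ} (V : HodgeCM.HermSpace3 L ι₁)

set_option synthInstance.maxHeartbeats 400000 in
set_option maxHeartbeats 8000000 in
-- heartbeats: the carriers `omegaAtLine … (hsChiD …)` elaborate the χ-attached splitting datum (same budget as ★ `exists_conjPartner_omegaAtLine_neg`).
/-- **R1b «ORIENTATION» OFF THE PIN — the clause for `ω(μ, ⟨a⟩, χ)` in `cohForms (archFactorOf L V)` from the HOLOMORPHIC clause of the conjugate
partners `ω(μ′, ⟨−a⟩, χ̄)`** (`μ′` of weight one with `HasCMType μ′ Φ̄_μ`; hypothesis shape = the conclusion of ★ ENGINE-GEN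
`exists_holTheta_atFrame_of_chiN` at `(μ′, χ̄, −a)`, conclusion shape = the input `hE` of ★ (Ta) `occursClause_cohForms_frame_of_archFactorOf`).
Proof: ★ `exists_conjPartner_omegaAtLine_neg` (a bijective conjugate-linear `U(V)(𝔸_f)`-equivariant `J`, [Liu2021, Lem. D.1 (2)]) ▸ §1 at
`σ g := rhoVAtLine … a χ (ιVE V g)`, `σ′ g := rhoVAtLine … (−a) χ̄ (ιVE V g)`.
[cite: Liu2021, App. D Lem. D.1 (2) (l. 5231), Lem. D.2 (2); proof of Prop. 4.13 l. 2145] [cite: BorelWallach2000, VII 2.10]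
[cite: GelbartRogawski1991, §3.1 Prop. 3.1.1 p. 455] -/
theorem occursClause_cohForms_of_conjPartner_hol
    (μ : Literature.NumberTheory.Automorphic.IdeleClassGroup (L : Type) →ₜ* Circle) (hμ : IsConjugateSymplectic (L : Type) μ)
    (hw : HasWeight (L : Type) μ 1) {Φ : Literature.AlgebraicGeometry.Motives.CMType (L : Type)} (hΦμ : HasCMType (L : Type) μ Φ)
    (a : (↥(maximalRealSubfield (L : Type)))ˣ) (χ : Chi ↥(maximalRealSubfield (L : Type)) (L : Type) (IsCMField.complexConj (L : Type)))
    (hhol : ∀ (μ' : Literature.NumberTheory.Automorphic.IdeleClassGroup (L : Type) →ₜ* Circle) (hμ' : IsConjugateSymplectic (L : Type) μ'),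
      HasWeight (L : Type) μ' 1 → HasCMType (L : Type) μ' (bar Φ) →
      ∃ θ' : omegaAtLine ↥(maximalRealSubfield (L : Type)) (L : Type) (IsCMField.complexConj (L : Type)) 3 e₁ (Matrix.diagonal (frameD V))
          (complexConj_imagUnit (L : Type)) (imagUnit_ne_zero (L : Type)) (imagUnit_mul_self (L : Type))
          (realDiagonal_isSymm (L : Type) (frameD V) (frameD_real V)) (isUnit_det_realDiagonal (L : Type) (frameD V) (frameD_real V) (frameD_ne V))
          (realDiagonal_map (L : Type) (frameD V) (frameD_real V)).symm
          (hsChiD (⟨HodgeCM.CMField.K L⟩ : Summit.HodgeConjecture.CorCM.CMField) e₁ (frameD V) (frameD_real V) (frameD_ne V)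
            (toHeckeCharacter (L : Type) μ') (isUnitary_toHeckeCharacter (L : Type) μ') (isSplittingChar_toHeckeCharacter_of_isConjugateSymplectic (L : Type) μ' hμ')) (-a)
          ⟨(Units.map ((starRingEnd ℂ : ℂ →+* ℂ) : ℂ →* ℂ)).comp χ.1,
              isAutomorphicOneChar_unitsMap_comp_chi (IsCMField.complexConj (L : Type)) χ _⟩ →ₗ[ℂ] ((adelicDatum L V).Adelic → (Fin 2 → ℂ)),
        θ' ≠ 0 ∧ (∀ v, θ' v ∈ holCotForms (archFactorOf L V)) ∧
          ∀ (g : ↥(HodgeCM.HermSpace3.adelicFin V))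
            (v : omegaAtLine ↥(maximalRealSubfield (L : Type)) (L : Type) (IsCMField.complexConj (L : Type)) 3 e₁ (Matrix.diagonal (frameD V))
              (complexConj_imagUnit (L : Type)) (imagUnit_ne_zero (L : Type)) (imagUnit_mul_self (L : Type))
              (realDiagonal_isSymm (L : Type) (frameD V) (frameD_real V)) (isUnit_det_realDiagonal (L : Type) (frameD V) (frameD_real V) (frameD_ne V))
              (realDiagonal_map (L : Type) (frameD V) (frameD_real V)).symm
              (hsChiD (⟨HodgeCM.CMField.K L⟩ : Summit.HodgeConjecture.CorCM.CMField) e₁ (frameD V) (frameD_real V) (frameD_ne V)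
                (toHeckeCharacter (L : Type) μ') (isUnitary_toHeckeCharacter (L : Type) μ') (isSplittingChar_toHeckeCharacter_of_isConjugateSymplectic (L : Type) μ' hμ')) (-a)
              ⟨(Units.map ((starRingEnd ℂ : ℂ →+* ℂ) : ℂ →* ℂ)).comp χ.1,
              isAutomorphicOneChar_unitsMap_comp_chi (IsCMField.complexConj (L : Type)) χ _⟩),
            θ' (rhoVAtLine ↥(maximalRealSubfield (L : Type)) (L : Type) (IsCMField.complexConj (L : Type)) 3 e₁ (Matrix.diagonal (frameD V))
                  (complexConj_imagUnit (L : Type)) (imagUnit_ne_zero (L : Type)) (imagUnit_mul_self (L : Type))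
                  (realDiagonal_isSymm (L : Type) (frameD V) (frameD_real V)) (isUnit_det_realDiagonal (L : Type) (frameD V) (frameD_real V) (frameD_ne V))
                  (realDiagonal_map (L : Type) (frameD V) (frameD_real V)).symm
                  (hsChiD (⟨HodgeCM.CMField.K L⟩ : Summit.HodgeConjecture.CorCM.CMField) e₁ (frameD V) (frameD_real V) (frameD_ne V)
                    (toHeckeCharacter (L : Type) μ') (isUnitary_toHeckeCharacter (L : Type) μ') (isSplittingChar_toHeckeCharacter_of_isConjugateSymplectic (L : Type) μ' hμ')) (-a)
                  ⟨(Units.map ((starRingEnd ℂ : ℂ →+* ℂ) : ℂ →* ℂ)).comp χ.1,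
              isAutomorphicOneChar_unitsMap_comp_chi (IsCMField.complexConj (L : Type)) χ _⟩ (ιVE V g) v) = rightRep L V g (θ' v)) :
    ∃ θ : omegaAtLine ↥(maximalRealSubfield (L : Type)) (L : Type) (IsCMField.complexConj (L : Type)) 3 e₁ (Matrix.diagonal (frameD V))
          (complexConj_imagUnit (L : Type)) (imagUnit_ne_zero (L : Type)) (imagUnit_mul_self (L : Type))
          (realDiagonal_isSymm (L : Type) (frameD V) (frameD_real V)) (isUnit_det_realDiagonal (L : Type) (frameD V) (frameD_real V) (frameD_ne V))
          (realDiagonal_map (L : Type) (frameD V) (frameD_real V)).symm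
          (hsChiD (⟨HodgeCM.CMField.K L⟩ : Summit.HodgeConjecture.CorCM.CMField) e₁ (frameD V) (frameD_real V) (frameD_ne V)
            (toHeckeCharacter (L : Type) μ) (isUnitary_toHeckeCharacter (L : Type) μ) (isSplittingChar_toHeckeCharacter_of_isConjugateSymplectic (L : Type) μ hμ)) a
          χ →ₗ[ℂ] ((adelicDatum L V).Adelic → (Fin 2 → ℂ)),
      θ ≠ 0 ∧ (∀ v, θ v ∈ cohForms (archFactorOf L V)) ∧
        ∀ (g : ↥(HodgeCM.HermSpace3.adelicFin V))
          (v : omegaAtLine ↥(maximalRealSubfield (L : Type)) (L : Type) (IsCMField.complexConj (L : Type)) 3 e₁ (Matrix.diagonal (frameD V))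
            (complexConj_imagUnit (L : Type)) (imagUnit_ne_zero (L : Type)) (imagUnit_mul_self (L : Type))
            (realDiagonal_isSymm (L : Type) (frameD V) (frameD_real V)) (isUnit_det_realDiagonal (L : Type) (frameD V) (frameD_real V) (frameD_ne V))
            (realDiagonal_map (L : Type) (frameD V) (frameD_real V)).symm
            (hsChiD (⟨HodgeCM.CMField.K L⟩ : Summit.HodgeConjecture.CorCM.CMField) e₁ (frameD V) (frameD_real V) (frameD_ne V)
              (toHeckeCharacter (L : Type) μ) (isUnitary_toHeckeCharacter (L : Type) μ) (isSplittingChar_toHeckeCharacter_of_isConjugateSymplectic (L : Type) μ hμ)) a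
            χ),
          θ (rhoVAtLine ↥(maximalRealSubfield (L : Type)) (L : Type) (IsCMField.complexConj (L : Type)) 3 e₁ (Matrix.diagonal (frameD V))
                (complexConj_imagUnit (L : Type)) (imagUnit_ne_zero (L : Type)) (imagUnit_mul_self (L : Type))
                (realDiagonal_isSymm (L : Type) (frameD V) (frameD_real V)) (isUnit_det_realDiagonal (L : Type) (frameD V) (frameD_real V) (frameD_ne V))
                (realDiagonal_map (L : Type) (frameD V) (frameD_real V)).symm
                (hsChiD (⟨HodgeCM.CMField.K L⟩ : Summit.HodgeConjecture.CorCM.CMField) e₁ (frameD V) (frameD_real V) (frameD_ne V)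
                  (toHeckeCharacter (L : Type) μ) (isUnitary_toHeckeCharacter (L : Type) μ) (isSplittingChar_toHeckeCharacter_of_isConjugateSymplectic (L : Type) μ hμ)) a
                χ (ιVE V g) v) = rightRep L V g (θ v) := by
  obtain ⟨μ', hμ', hw', hΦ', J, hJ, hJeq⟩ :=
    exists_conjPartner_omegaAtLine_neg V μ hμ hw hΦμ (isSplittingChar_toHeckeCharacter_of_isConjugateSymplectic (L : Type) μ hμ) a χ
  exact occursClause_cohForms_of_semilinear_partner L V (archFactorOf L V) (fun g v => _) (fun g v => _) J hJ.2
    (fun g v => hJeq (ιVE V g) v) (hhol μ' hμ' hw' hΦ')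

end Partner

end Summit.HodgeConjecture.HodgeConjecture.Cruxes.H413.F0P2tOccursClauseViaPartner

end
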